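import Summits.HodgeConjecture.HodgeConjecture.Theorems.VHCAbelianSchemesRoadSecantAnchorInhabitedDefs
import Literature.AlgebraicGeometry.HodgeTheory.IsoTransport

/-!
# `SemiregularSheafRepresentativesTwAtDiag` (stmt-HodgeConjecture-19787) · Negative · the family-supply hypothesis
# `SecantAnchorWeilPencilSupply` forgets the Hodge type of the served class

`Summit.HodgeConjecture.HodgeConjecture.Ring2.SemiregularRepresentatives.SecantAnchorWeilPencilSupply` (the input `hsup` of
`…SecantQuotientAnchorMarkman` §3 and of `…SecantAnchorInhabited`) quantifies over data `(d, P, Y, ψ₀, q, h, γ)` whose binders —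
`IsPolarizationClass 6 Y.X h` (rational, divisor-supported, hard Lefschetz: NO positivity), `IsHyperbolicWeilType P ψ₀ 3 (q^*h)`
(a rational `ψ₀^*`-stable `Q_{q^*h}`-Lagrangian frame: NO compatibility `ψ₀^*(q^*h) = d · q^*h`), `IsRationalClass γ`, `γ ∉ ℂ·h³`,
`q^*γ ∈ weilClassesOf P ψ₀ 3 d` (the two `ψ₀^*`-eigenlines `⋀⁶V₊ ⊕ ⋀⁶V₋`) — do NOT force `γ` to be of Hodge type `(3,3)`, while its
conclusion `γ ∈ exceptionalPencilClassesThrough 6 3 Y.X h` DOES: the pencil carries a global class `W` of type `(3,3)` on every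
fibre with `W|_{sₐ} = (e⁻¹)^* γ`, and Hodge types transport along the isomorphism `e : Y.X ≅ 𝒳_{sₐ}`
(`isOfHodgeType_of_mem_exceptionalPencilClassesThrough`).  Hence every OFF-TYPE hyperbolic Weil datum — a datum satisfying the
binders with `γ` NOT of type `(3,3)` — falsifies the hypothesis (`not_secantAnchorWeilPencilSupply_of_offType`).  Such data exist
on paper: `P = Y = E⁶` for a CM elliptic curve `E` with `r ≫ r = -3`, `q = 𝟙`, `d = 3`, `ψ₀ = r^{×6}` (K-multiplicities `(6,0)`),
the INDEFINITE divisor class `h = ω₁ + ω₂ + ω₃ - ω₄ - ω₅ - ω₆` (`ω_k = pr_k^*[pt]`; rational, algebraic, hard Lefschetz by the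
exterior transport of `RosatiClassRealTwist.hasHardLefschetzProperty_exteriorPullback`; `Q_h ≅ diag(1,1,1,-1,-1,-1)` hermitian
over `ℚ(√-3)`, rational `r^*`-stable Lagrangian `span_K{e₁+e₄, e₂+e₅, e₃+e₆}`), and `γ = ∏ pr_k^* v₊ + ∏ pr_k^* v₋ ∈ H^{6,0} ⊕ H^{0,6}`
rational, `≠ 0`, outside `ℂ·h³`.  With an AMPLE `h` a rational `ψ₀`-stable Lagrangian forces balanced multiplicities `(3,3)`,
so the gap is exactly the missing positivity / type binder.  Minimal repair: add the binder `IsOfHodgeType 6 Y.X (2 * 3) 3 3 γ →`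
(Markman's served class `κ₃ - c₃θ³` is algebraic, hence satisfies it).  Refuter seat refuter-pub-hodge-ring2-refute-markman-g1-0
(hostile read of p498645 / p509795 / p513733, REFUTE-MARKMAN-G1.md), 2026-08-27.
[cite: vanGeemen1994HodgeAV, Lemma 5.2 and 5.3–5.5] [cite: Deligne1982HodgeCycles, §4 Prop. 4.4 and Cor. 4.2]
[cite: VoisinHodgeI2002, §7.1.1]
-/

noncomputable section

open CategoryTheory
open Literature.AlgebraicTopology.SingularHomology
open Literature.AlgebraicGeometry Literature.AlgebraicGeometry.Motives Literature.AlgebraicGeometry.HodgeTheory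

namespace Summit.HodgeConjecture.HodgeConjecture.Theorems.SemiregularSheafRepresentativesTwAtDiag.Negative.SecantAnchorWeilPencilSupplyFalseOfOffType

-- the cell's namespace repeats the summit name (`Summit.HodgeConjecture.HodgeConjecture…`), as in every `Ring2*` file
set_option linter.dupNamespace false

open Summit.HodgeConjecture.HodgeConjecture.Ring2.SemiregularRepresentatives

/-- **A class continued along a cell-shaped pencil is of Hodge type `(p,p)`**: membership in
`exceptionalPencilClassesThrough n p X θ` provides a global class `W` of type `(p,p)` on every fibre with
`W|_{sₐ} = (e⁻¹)^* w`, and Hodge types transport along `e⁻¹ : 𝒳_{sₐ} ≅ X`. [cite: VoisinHodgeI2002, §7.1.1] -/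
theorem isOfHodgeType_of_mem_exceptionalPencilClassesThrough {n p : ℕ} {X : SchemeOver ℂ} {θ : complexBetti X 2}
    {w : complexBetti X (2 * p)} (hw : w ∈ exceptionalPencilClassesThrough n p X θ) :
    IsOfHodgeType n X (2 * p) p p w := by
  obtain ⟨𝒳, S, f, sₐ, e, Θ, W, -, -, -, -, -, -, -, -, -, -, hW, -, hWa, -⟩ := hw
  have h := (hW sₐ).2
  rw [hWa] at h
  exact IsOfHodgeType.of_map_iso e.symm h

/-- The same for the polarising class: `θ` is of Hodge type `(1,1)` on `X`. [cite: VoisinHodgeI2002, §7.1.1] -/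
theorem isOfHodgeType_one_one_of_mem_exceptionalPencilClassesThrough {n p : ℕ} {X : SchemeOver ℂ} {θ : complexBetti X 2}
    {w : complexBetti X (2 * p)} (hw : w ∈ exceptionalPencilClassesThrough n p X θ) :
    IsOfHodgeType n X 2 1 1 θ := by
  obtain ⟨𝒳, S, f, sₐ, e, Θ, W, -, -, -, -, -, -, -, -, -, hΘ, -, hΘa, -, -⟩ := hw
  have h := hΘ sₐ
  rw [hΘa] at h
  exact IsOfHodgeType.of_map_iso e.symm h

/-- **`SecantAnchorWeilPencilSupply` implies the type constraint it does not state**: under the hypothesis, every datum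
satisfying its binders has `γ` of Hodge type `(3,3)`. [cite: VoisinHodgeI2002, §7.1.1] -/
theorem isOfHodgeType_of_secantAnchorWeilPencilSupply (hsup : SecantAnchorWeilPencilSupply)
    {d : ℕ} {P Y : AbelianVariety ℂ} {ψ₀ : P ⟶ P} {q : P ⟶ Y} {h : complexBetti Y.X 2}
    {γ : complexBetti Y.X (2 * 3)} (hd : 0 < d) (hP : P.dim = 6) (hY : Y.dim = 6) (hψ : ψ₀ ≫ ψ₀ = -(d • 𝟙 P))
    (hq : ∀ k : ℕ, Function.Bijective (complexBetti.map q.hom.hom.hom k)) (hh : IsPolarizationClass 6 Y.X h)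
    (hhyp : IsHyperbolicWeilType P ψ₀ 3 (complexBetti.map q.hom.hom.hom 2 h)) (hγr : IsRationalClass γ)
    (hγ : γ ∉ (ℂ ∙ cupPowTwo h 3)) (hγW : complexBetti.map q.hom.hom.hom (2 * 3) γ ∈ weilClassesOf P ψ₀ 3 d) :
    IsOfHodgeType 6 Y.X (2 * 3) 3 3 γ :=
  isOfHodgeType_of_mem_exceptionalPencilClassesThrough (hsup d P Y ψ₀ q h γ hd hP hY hψ hq hh hhyp hγr hγ hγW)

/-- **`SecantAnchorWeilPencilSupply` is FALSE at every off-type hyperbolic Weil datum**: a datum satisfying all its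
binders whose class `γ` is NOT of Hodge type `(3,3)` (on paper: `E⁶`, `E` CM by `√-3`, `ψ₀ = r^{×6}`, the indefinite class
`h = ω₁+ω₂+ω₃-ω₄-ω₅-ω₆`, `γ ∈ H^{6,0} ⊕ H^{0,6}` rational) refutes it — the binders carry no positivity of `h` and no
compatibility `ψ₀^* h = d · h`, which is what makes Weil classes of type `(3,3)` in print.
[cite: vanGeemen1994HodgeAV, Lemma 5.2] [cite: Deligne1982HodgeCycles, §4 Prop. 4.4] -/
theorem not_secantAnchorWeilPencilSupply_of_offType
    {d : ℕ} {P Y : AbelianVariety ℂ} {ψ₀ : P ⟶ P} {q : P ⟶ Y} {h : complexBetti Y.X 2}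
    {γ : complexBetti Y.X (2 * 3)} (hd : 0 < d) (hP : P.dim = 6) (hY : Y.dim = 6) (hψ : ψ₀ ≫ ψ₀ = -(d • 𝟙 P))
    (hq : ∀ k : ℕ, Function.Bijective (complexBetti.map q.hom.hom.hom k)) (hh : IsPolarizationClass 6 Y.X h)
    (hhyp : IsHyperbolicWeilType P ψ₀ 3 (complexBetti.map q.hom.hom.hom 2 h)) (hγr : IsRationalClass γ)
    (hγ : γ ∉ (ℂ ∙ cupPowTwo h 3)) (hγW : complexBetti.map q.hom.hom.hom (2 * 3) γ ∈ weilClassesOf P ψ₀ 3 d)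
    (hoff : ¬ IsOfHodgeType 6 Y.X (2 * 3) 3 3 γ) : ¬ SecantAnchorWeilPencilSupply := fun hsup ↦
  hoff (isOfHodgeType_of_secantAnchorWeilPencilSupply hsup hd hP hY hψ hq hh hhyp hγr hγ hγW)

end Summit.HodgeConjecture.HodgeConjecture.Theorems.SemiregularSheafRepresentativesTwAtDiag.Negative.SecantAnchorWeilPencilSupplyFalseOfOffType

end
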